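import Summits.QuantumFields.YangMills.Theorems.TwistedTraceScaling.Negative.SmearingWindowSchedule
import HarnessLib

/-!
# R53 (crux `TwistedTraceScaling`, stmt-QuantumFields-20203; the ACTION WINDOW of lane A's (C1) record on the landed schedule B): with `T(β) = 9L·(5β^{-1/2}ℓ²) + β^{-1}`
# (`ℓ = btLog β ≥ log β`) one has `βT² ≥ 2025·L²·ℓ⁴`, so the action window `σ = β^{-q}` of the smearing amplitude `χ₀ = 𝟙{‖q(u_k)−1‖ ≤ δu ∧ L³S₁(u) ≤ σ}` is priced by the
# (OD) budget EXACTLY on the band `q > 1/3`; lane A's draft record (`pub/ym-fleet/ym-luscher-20007-p1/g18-BOCentralRecord-draft.lean`, 2026-08-29T06:04Z,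
# `central_transfer_record`) takes `σ = powScale (1/3) β` — the excluded endpoint: `η₀ ≥ 1728·2025·N_P·L²·(log β)⁴·β^{-1/6}`, so `η₀·β^{1/6} → ∞` and `hb_small` fails

Standing disprover `ym-cdisprove-20203-1` (gen 42), sequel to R50 (`…Negative.SmearingWindowCost`: the action floor `1728N_P·βT²·√σ ≤ coreEta L β 0 δu T R Γ σ`; `σ = β^{-s}`,
`s < 1/3`, kills the budget on any scale with `βT² ≥ 1`), R50T (`…Negative.SmearingWindowBand`: polylog windows affordable iff exponent `> 1/6`) and R52
(`…Negative.SmearingWindowSchedule`: `2025 ≤ βT² ≤ (45L+1)²ℓ⁴` on the landed `T`; window band `1/6 < s' < 1/2`).  R52 left `s' = 1/6` (equivalently the action exponent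
`q = 1/3`, `√σ = β^{-q/2}`) open «R50's strictness»; R21's `offDiag_budget_at_one_sixth` shows that a CONSTANT first-order `κβ^{-1/6}` is affordable iff
`16κ² ≤ εθ(2/L³)^{1/3}`.  On schedule B the endpoint is NOT affordable, for a structural reason: `T ≥ 45L·β^{-1/2}ℓ²` carries `ℓ² = btLog²β ≥ log²β`, so the «constant»
in front of `β^{-1/6}` grows like `(log β)⁴`:
* §1 `logpow_le_beta_schedT_sq` — `2025·L²·ℓ⁴ ≤ βT(β)²` for `β ≥ 1` (R52's `one_le_beta_schedT_sq` kept only `2025`);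
* §2 `coreEta_ge_action_third` — with `σ = powScale (1/3) β`: `1728N_P·(2025L²)·ℓ⁴·powScale (1/6) β ≤ coreEta L β 0 δu T(β) R Γ σ` (`β ≥ 1`, `δu ≥ 0`, any `R, Γ`);
* §3 ★★★ `sched_action_budget_false_at_third` — for every `δu ≥ 0`, `R`, `Γ` (functions of `β`) and EVERY real `ε, θ`:
  `¬ ∃ β₀, ∀ β ≥ β₀, ∃ b, coreEta L β 0 (δu β) (T β) (R β) (Γ β) (powScale (1/3) β) ≤ b ∧ b² ≤ εθ·λ_b(L³β)/16`
  (`λ_b(L³β) = (2/L³)^{1/3}β^{-1/3}`; after cancelling `β^{-1/3}`: `(1728·2025·N_P·L²)²ℓ⁸ ≤ εθ(2/L³)^{1/3}/16`, false at `β ≥ exp(|C₀|/A² + 1)`);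
  ★★★ `not_hb_small_of_action_third` — the package field `hb_small : ∀ a > 0, ∀ᶠ β, b(β)² ≤ a·λ_b(L³β)` (`…BOAssemblyBricks`, `…BTRecord`, `…BTGaussianProfile`) fails for
  every off-diagonal constant `b ≥ η₀` eventually (the (B-OD) door's relative error is `η = e^{η₀} − 1 ≥ η₀`, `…BODoor`);
* §4 ★★ `sched_action_term_affordable` — for `σ = powScale q β` with `q > 1/3` the action floor `1728N_P·βT²·√σ ≤ 1728N_P(45L+1)²(log β)⁴·powScale (q/2) β` is affordable
  for every `ε, θ > 0` (R50T `polylog_window_affordable`, `m = 4`); `sched_action_budget_false_le_third` — every `q ≤ 1/3` fails (R50 below, §3 at the endpoint).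
  So on the landed schedule the admissible exponents are EXACTLY: window `s' > 1/6` (R52) and action `q > 1/3` (this file); the draft's `(s', q) = (1/3, 1/3)` has the
  window inside its band and the action window ON the excluded endpoint.
READING (no kill; a schedule constant to change before landing): `σ` enters `coreEta`/`coreEps2` only polynomially (`50σN₃βR²`, `stepActionErr T σ = N_P(1728T²√σ + …)`; no
`1/σ`, no `log σ`), the window floor `hχlo` needs only `σ ≥ 12L³a_W⁴ = O(β^{-2}ℓ⁸·poly(L,K_sp))` (`a_W = O(K_sp Lβ^{-1/2}ℓ²)`, `…BOLocalisedAvgChartLowerSharp`) and `I₀ > 0` holds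
for every `σ > 0` (`…BOCentralWindow.slowWindow_I0_pos`): REPAIR `σ := powScale q β` with any `1/3 < q < 2`, e.g. `q = 1/2` (then `1728N_PβT²√σ = O(L⁵ℓ⁴β^{-1/4})`) or `q = 1`.
The draft's input window `δu = powScale (1/3) β` is inside R52's band (example below).
HONEST FRAMING: exponent bookkeeping about a DRAFT assembly (not in the tree) of bricks of a stub of a child of the CONDITIONAL reduction route R2b1; nothing landed is refuted
(the (C1) theorems are implications, true for every `σ`); (C1) rates, (C4), (C5), (B-ST), C4-CORE OPEN; not infinite volume, not a gap, not Clay.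
-/

set_option autoImplicit false

noncomputable section

open Real Filter
open Literature.MathematicalPhysics.QuantumFieldTheory
open Literature.MathematicalPhysics.QuantumLattice
open Summit.QuantumFields.YangMills.Theorems.FemtoTransferGap
open Summit.QuantumFields.YangMills.Theorems.FemtoTransferGap.TwoLattice
open Summit.QuantumFields.YangMills.Theorems.FemtoTransferGap.TwoLattice.ConstTube (coreEta btLog one_le_btLog schedT_le eventually_btLog_eq mul_powScale_half_sq)

namespace Summit.QuantumFields.YangMills.Theorems.TwistedTraceScaling.Negative.R53

variable {L : ℕ} [NeZero L]

/-! ## §1 The log-sharp lower bound `2025·L²·ℓ⁴ ≤ βT(β)²` on the landed schedule -/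

omit [NeZero L] in
/-- `log β ≤ ℓ(β) = max(log β, 1)`. [folklore] -/
theorem log_le_btLog (β : ℝ) : Real.log β ≤ btLog β := le_max_left _ _

/-- **Lower bound with the polylog kept**: `2025·L²·ℓ⁴ ≤ β·T(β)²` for `β ≥ 1` (`T ≥ 45L·β^{-1/2}ℓ²`, `β·(β^{-1/2})² = 1`). [folklore] -/
theorem logpow_le_beta_schedT_sq {β : ℝ} (hβ : 1 ≤ β) :
    2025 * (L : ℝ) ^ 2 * btLog β ^ 4 ≤ β * (9 * (L : ℝ) * (5 * (powScale (1 / 2) β * btLog β ^ 2)) + powScale 1 β) ^ 2 := by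
  have hL : (1 : ℝ) ≤ (L : ℝ) := by exact_mod_cast Nat.one_le_iff_ne_zero.mpr (NeZero.ne L)
  have hℓ := one_le_btLog β
  have hx0 : 0 < powScale (1 / 2) β := powScale_pos _ _
  have h10 : 0 < powScale 1 β := powScale_pos _ _
  have hsq : β * powScale (1 / 2) β ^ 2 = 1 := mul_powScale_half_sq hβ
  have hβ0 : 0 ≤ β := by linarith
  have hT0 : 0 ≤ 45 * (L : ℝ) * (powScale (1 / 2) β * btLog β ^ 2) := by positivity
  have hT : 45 * (L : ℝ) * (powScale (1 / 2) β * btLog β ^ 2) ≤ 9 * (L : ℝ) * (5 * (powScale (1 / 2) β * btLog β ^ 2)) + powScale 1 β := by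
    have e : 45 * (L : ℝ) * (powScale (1 / 2) β * btLog β ^ 2) = 9 * (L : ℝ) * (5 * (powScale (1 / 2) β * btLog β ^ 2)) := by ring
    linarith [h10.le]
  calc 2025 * (L : ℝ) ^ 2 * btLog β ^ 4 = (β * powScale (1 / 2) β ^ 2) * (2025 * (L : ℝ) ^ 2 * btLog β ^ 4) := by rw [hsq, one_mul]
    _ = β * (45 * (L : ℝ) * (powScale (1 / 2) β * btLog β ^ 2)) ^ 2 := by ring
    _ ≤ β * (9 * (L : ℝ) * (5 * (powScale (1 / 2) β * btLog β ^ 2)) + powScale 1 β) ^ 2 :=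
        mul_le_mul_of_nonneg_left (pow_le_pow_left₀ hT0 hT 2) hβ0

/-- In particular `2025·(log β)⁴ ≤ β·T(β)²` for `β ≥ 1` with `log β ≥ 0`… stated with `ℓ`: `2025·ℓ⁴ ≤ βT²` (`L ≥ 1`). [folklore] -/
theorem logpow_le_beta_schedT_sq' {β : ℝ} (hβ : 1 ≤ β) :
    2025 * btLog β ^ 4 ≤ β * (9 * (L : ℝ) * (5 * (powScale (1 / 2) β * btLog β ^ 2)) + powScale 1 β) ^ 2 := by
  have hL : (1 : ℝ) ≤ (L : ℝ) := by exact_mod_cast Nat.one_le_iff_ne_zero.mpr (NeZero.ne L)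
  have hL2 : (1 : ℝ) ≤ (L : ℝ) ^ 2 := one_le_pow₀ hL
  have hℓ4 : 0 ≤ btLog β ^ 4 := by positivity
  have h := logpow_le_beta_schedT_sq (L := L) hβ
  nlinarith [mul_le_mul_of_nonneg_left hL2 (mul_nonneg (by norm_num : (0:ℝ) ≤ 2025) hℓ4)]

/-! ## §2 The action floor at the draft's `σ = powScale (1/3) β` -/

/-- **THE ACTION FLOOR AT `σ = β^{-1/3}` ON SCHEDULE B**: `1728N_P·(2025L²)·ℓ⁴·powScale (1/6) β ≤ coreEta L β 0 δu T(β) R Γ (powScale (1/3) β)` (`β ≥ 1`, `δu ≥ 0`;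
R50 `coreEta_ge_sqrtAction` + `√(powScale (1/3) β) = powScale (1/6) β` + §1). [folklore] -/
theorem coreEta_ge_action_third {β δu R Γ : ℝ} (hβ : 1 ≤ β) (hδu : 0 ≤ δu) :
    1728 * (Fintype.card (Plaquette 3 L) : ℝ) * (2025 * (L : ℝ) ^ 2) * (btLog β ^ 4 * powScale (1 / 6) β) ≤
      coreEta L β 0 δu (9 * (L : ℝ) * (5 * (powScale (1 / 2) β * btLog β ^ 2)) + powScale 1 β) R Γ (powScale (1 / 3) β) := by
  have hβ0 : 0 ≤ β := by linarith
  have hT0 := R52.schedT_nonneg (L := L) β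
  have h := R50.coreEta_ge_sqrtAction (L := L) (R := R) (Γ := Γ) (T := 9 * (L : ℝ) * (5 * (powScale (1 / 2) β * btLog β ^ 2)) + powScale 1 β)
    hβ0 hδu hT0 (powScale_pos (1 / 3) β).le
  rw [R50.sqrt_powScale, show ((1 : ℝ) / 3 / 2) = 1 / 6 by norm_num] at h
  refine le_trans ?_ h
  have hlow := logpow_le_beta_schedT_sq (L := L) hβ
  have hps := (powScale_pos (1 / 6) β).le
  have hN : 0 ≤ 1728 * (Fintype.card (Plaquette 3 L) : ℝ) := by positivity
  calc 1728 * (Fintype.card (Plaquette 3 L) : ℝ) * (2025 * (L : ℝ) ^ 2) * (btLog β ^ 4 * powScale (1 / 6) β)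
      = 1728 * (Fintype.card (Plaquette 3 L) : ℝ) * (2025 * (L : ℝ) ^ 2 * btLog β ^ 4) * powScale (1 / 6) β := by ring
    _ ≤ 1728 * (Fintype.card (Plaquette 3 L) : ℝ) * (β * (9 * (L : ℝ) * (5 * (powScale (1 / 2) β * btLog β ^ 2)) + powScale 1 β) ^ 2) *
          powScale (1 / 6) β := mul_le_mul_of_nonneg_right (mul_le_mul_of_nonneg_left hlow hN) hps
    _ = 1728 * (Fintype.card (Plaquette 3 L) : ℝ) * β * (9 * (L : ℝ) * (5 * (powScale (1 / 2) β * btLog β ^ 2)) + powScale 1 β) ^ 2 *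
          powScale (1 / 6) β := by ring

/-- `0 < 1728·N_P·(2025L²)` (`N_P = 3L³ ≥ 3`). [folklore] -/
theorem thirdCoeff_pos : 0 < 1728 * (Fintype.card (Plaquette 3 L) : ℝ) * (2025 * (L : ℝ) ^ 2) := by
  have hL : (0 : ℝ) < (L : ℝ) := by exact_mod_cast Nat.pos_of_ne_zero (NeZero.ne L)
  exact mul_pos (R50.actionCoeff_pos (L := L)) (by positivity)

/-- `λ_b(L³β) = (2/L³)^{1/3}·powScale (1/3) β` for `β ≥ 1`. [folklore] -/
theorem bareLambda_cube_eq_powScale {β : ℝ} (hβ : 1 ≤ β) :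
    bareLambda ((L : ℝ) ^ 3 * β) = (2 / (L : ℝ) ^ 3) ^ ((1 : ℝ) / 3) * powScale (1 / 3) β := by
  have hβ0 : 0 < β := by linarith
  rw [bareLambda_cube_eq (L := L) hβ0, powScale_eq hβ, show (-(1 : ℝ) / 3) = -(1 / 3 : ℝ) by ring]

/-! ## §3 ★★★ The (OD) budget fails at the endpoint `q = 1/3` on the landed schedule — for EVERY `ε, θ` -/

/-- ★★★ **`σ = β^{-1/3}` KILLS THE OFF-DIAGONAL BUDGET ON SCHEDULE B** (every `L ≥ 1`, every real `ε, θ`, every `δu ≥ 0`, `R`, `Γ`): there is NO threshold beyond which some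
`b ≥ η₀(β) = coreEta L β 0 (δu β) (T β) (R β) (Γ β) (powScale (1/3) β)` satisfies `b² ≤ εθ·λ_b(L³β)/16` — `b ≥ A·ℓ⁴·β^{-1/6}` (`A = 1728·2025·N_P·L²`) gives
`A²ℓ⁸ ≤ εθ(2/L³)^{1/3}/16` after cancelling `β^{-1/3}`, false once `log β ≥ |εθ(2/L³)^{1/3}/16|/A² + 1`. [cite: Luscher1983, §3] -/
theorem sched_action_budget_false_at_third {δu R Γ : ℝ → ℝ} (hδu0 : ∀ β, 0 ≤ δu β) (ε θ : ℝ) :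
    ¬ ∃ β0 : ℝ, ∀ β : ℝ, β0 ≤ β → ∃ b : ℝ,
      coreEta L β 0 (δu β) (9 * (L : ℝ) * (5 * (powScale (1 / 2) β * btLog β ^ 2)) + powScale 1 β) (R β) (Γ β) (powScale (1 / 3) β) ≤ b ∧
        b ^ 2 ≤ ε * θ * bareLambda ((L : ℝ) ^ 3 * β) / 16 := by
  rintro ⟨β0, h⟩
  obtain ⟨A, hA⟩ : ∃ A : ℝ, A = 1728 * (Fintype.card (Plaquette 3 L) : ℝ) * (2025 * (L : ℝ) ^ 2) := ⟨_, rfl⟩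
  have hA0 : 0 < A := by rw [hA]; exact thirdCoeff_pos (L := L)
  have hA2 : 0 < A ^ 2 := by positivity
  obtain ⟨C0, hC0⟩ : ∃ C0 : ℝ, C0 = ε * θ * (2 / (L : ℝ) ^ 3) ^ ((1 : ℝ) / 3) / 16 := ⟨_, rfl⟩
  obtain ⟨M, hM⟩ : ∃ M : ℝ, M = |C0| / A ^ 2 + 1 := ⟨_, rfl⟩
  -- the large `β`
  obtain ⟨β, hβdef⟩ : ∃ β : ℝ, β = max (max β0 1) (Real.exp M) := ⟨_, rfl⟩
  have hβ0' : β0 ≤ β := by rw [hβdef]; exact le_trans (le_max_left _ _) (le_max_left _ _)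
  have hβ1 : 1 ≤ β := by rw [hβdef]; exact le_trans (le_max_right _ _) (le_max_left _ _)
  have hβM : Real.exp M ≤ β := by rw [hβdef]; exact le_max_right _ _
  have hlog : M ≤ Real.log β := by rw [← Real.log_exp M]; exact Real.log_le_log (Real.exp_pos M) hβM
  have hℓM : M ≤ btLog β := hlog.trans (log_le_btLog β)
  have hℓ1 : 1 ≤ btLog β := one_le_btLog β
  obtain ⟨b, hb, hb2⟩ := h β hβ0'
  -- the floor `A·ℓ⁴·β^{-1/6} ≤ b`
  have hfloor := coreEta_ge_action_third (L := L) (R := R β) (Γ := Γ β) hβ1 (hδu0 β)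
  rw [← hA] at hfloor
  have hAb : A * (btLog β ^ 4 * powScale (1 / 6) β) ≤ b := hfloor.trans hb
  have hy0 : 0 ≤ A * (btLog β ^ 4 * powScale (1 / 6) β) := mul_nonneg hA0.le (mul_nonneg (by positivity) (powScale_pos _ _).le)
  have hsq : (A * (btLog β ^ 4 * powScale (1 / 6) β)) ^ 2 ≤ b ^ 2 := pow_le_pow_left₀ hy0 hAb 2
  have hp : powScale (1 / 6) β ^ 2 = powScale (1 / 3) β := by rw [R21.powScale_sq]; norm_num
  have e1 : (A * (btLog β ^ 4 * powScale (1 / 6) β)) ^ 2 = A ^ 2 * btLog β ^ 8 * powScale (1 / 3) β := by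
    rw [mul_pow, mul_pow, hp]; ring
  have e2 : ε * θ * bareLambda ((L : ℝ) ^ 3 * β) / 16 = C0 * powScale (1 / 3) β := by
    rw [bareLambda_cube_eq_powScale (L := L) hβ1, hC0]; ring
  have key : A ^ 2 * btLog β ^ 8 * powScale (1 / 3) β ≤ C0 * powScale (1 / 3) β := by
    calc A ^ 2 * btLog β ^ 8 * powScale (1 / 3) β = (A * (btLog β ^ 4 * powScale (1 / 6) β)) ^ 2 := e1.symm
      _ ≤ b ^ 2 := hsq
      _ ≤ ε * θ * bareLambda ((L : ℝ) ^ 3 * β) / 16 := hb2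
      _ = C0 * powScale (1 / 3) β := e2
  have hp3 : 0 < powScale (1 / 3) β := powScale_pos _ _
  have key' : A ^ 2 * btLog β ^ 8 ≤ C0 := le_of_mul_le_mul_right key hp3
  -- but `A²ℓ⁸ ≥ A²ℓ ≥ A²M = |C₀| + A² > C₀`
  have hℓ8 : btLog β ≤ btLog β ^ 8 := le_self_pow₀ hℓ1 (by norm_num)
  have h1 : A ^ 2 * M ≤ A ^ 2 * btLog β ^ 8 := mul_le_mul_of_nonneg_left (hℓM.trans hℓ8) hA2.le
  have h2 : A ^ 2 * M = |C0| + A ^ 2 := by rw [hM]; field_simp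
  have h3 : C0 ≤ |C0| := le_abs_self _
  linarith

/-- ★★★ **`hb_small` FAILS FOR EVERY OFF-DIAGONAL CONSTANT ABOVE THE SMEARING EXPONENT** (draft schedule, `σ = β^{-1/3}`): if `η₀(β) ≤ b(β)` eventually, then the package
field `∀ a > 0, ∀ᶠ β, b(β)² ≤ a·λ_b(L³β)` (`…BOAssemblyBricks`/`…BTRecord`/`…BTGaussianProfile`'s `hb_small`) is false — already `a = 1` fails. [cite: Luscher1983, §3] -/
theorem not_hb_small_of_action_third {δu R Γ bOD : ℝ → ℝ} (hδu0 : ∀ β, 0 ≤ δu β)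
    (hfloor : ∀ᶠ β : ℝ in atTop,
      coreEta L β 0 (δu β) (9 * (L : ℝ) * (5 * (powScale (1 / 2) β * btLog β ^ 2)) + powScale 1 β) (R β) (Γ β) (powScale (1 / 3) β) ≤ bOD β) :
    ¬ ∀ a : ℝ, 0 < a → ∀ᶠ β : ℝ in atTop, bOD β ^ 2 ≤ a * bareLambda ((L : ℝ) ^ 3 * β) := by
  intro hsmall
  obtain ⟨β0, hβ0⟩ := Filter.eventually_atTop.mp (hfloor.and (hsmall 1 one_pos))
  refine sched_action_budget_false_at_third (L := L) (R := R) (Γ := Γ) hδu0 16 1 ⟨β0, fun β hβ => ⟨bOD β, (hβ0 β hβ).1, ?_⟩⟩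
  have h2 := (hβ0 β hβ).2
  linarith

/-! ## §4 ★★ The band: every `q ≤ 1/3` fails, every `q > 1/3` is affordable -/

/-- Every action exponent `q ≤ 1/3` fails on schedule B (`q < 1/3`: R50 `smearing_offDiag_budget_false_of_action` with R52's `βT² ≥ 1`; `q = 1/3`: §3). [cite: Luscher1983, §3] -/
theorem sched_action_budget_false_le_third {q : ℝ} (hq : q ≤ 1 / 3) {δu R Γ : ℝ → ℝ} (hδu0 : ∀ β, 0 ≤ δu β) (ε θ : ℝ) :
    ¬ ∃ β0 : ℝ, ∀ β : ℝ, β0 ≤ β → ∃ b : ℝ,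
      coreEta L β 0 (δu β) (9 * (L : ℝ) * (5 * (powScale (1 / 2) β * btLog β ^ 2)) + powScale 1 β) (R β) (Γ β) (powScale q β) ≤ b ∧
        b ^ 2 ≤ ε * θ * bareLambda ((L : ℝ) ^ 3 * β) / 16 := by
  rcases lt_or_eq_of_le hq with hlt | heq
  · exact R50.smearing_offDiag_budget_false_of_action (L := L) hlt hδu0 (fun β => R52.schedT_nonneg (L := L) β)
      ⟨1, fun β hβ => (R52.one_le_beta_schedT_sq (L := L) hβ).2⟩ ε θ
  · rw [heq]; exact sched_action_budget_false_at_third (L := L) hδu0 ε θ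

/-- ★★ **EVERY `q > 1/3` IS AFFORDABLE** (the action-floor TERM): with `σ = powScale q β`, `q > 1/3`, R50's action floor `1728N_P·β·T(β)²·√σ` is eventually below some `b`
with `b² ≤ εθλ_b(L³β)/16` (`ε, θ > 0`) — `βT² ≤ (45L+1)²ℓ⁴`, `ℓ = log β` for `β ≥ e`, `√σ = powScale (q/2) β`, R50T `polylog_window_affordable` with `m = 4`.
[cite: Luscher1983, §3] -/
theorem sched_action_term_affordable {q ε θ : ℝ} (hq : 1 / 3 < q) (hε : 0 < ε) (hθ : 0 < θ) :
    ∃ β0 : ℝ, ∀ β : ℝ, β0 ≤ β → ∃ b : ℝ,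
      1728 * (Fintype.card (Plaquette 3 L) : ℝ) * β * (9 * (L : ℝ) * (5 * (powScale (1 / 2) β * btLog β ^ 2)) + powScale 1 β) ^ 2 *
          Real.sqrt (powScale q β) ≤ b ∧
        b ^ 2 ≤ ε * θ * bareLambda ((L : ℝ) ^ 3 * β) / 16 := by
  have hs : 1 / 6 < q / 2 := by linarith
  have hA : 0 ≤ 1728 * (Fintype.card (Plaquette 3 L) : ℝ) * (45 * (L : ℝ) + 1) ^ 2 := by positivity
  obtain ⟨β0, h⟩ := R50T.polylog_window_affordable (L := L) (s := q / 2) (A := 1728 * (Fintype.card (Plaquette 3 L) : ℝ) * (45 * (L : ℝ) + 1) ^ 2)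
    4 hs hA hε hθ
  obtain ⟨βe, hβe⟩ := Filter.eventually_atTop.mp (eventually_btLog_eq)
  refine ⟨max (max β0 βe) 1, fun β hβ => ?_⟩
  have hβ0 : β0 ≤ β := le_trans (le_trans (le_max_left _ _) (le_max_left _ _)) hβ
  have hβe' : βe ≤ β := le_trans (le_trans (le_max_right _ _) (le_max_left _ _)) hβ
  have hβ1 : 1 ≤ β := le_trans (le_max_right _ _) hβ
  obtain ⟨b, hb, hb2⟩ := h β hβ0
  refine ⟨b, le_trans ?_ hb, hb2⟩
  have hℓ : btLog β = Real.log β := hβe β hβe'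
  have hup := R52.beta_schedT_sq_le (L := L) hβ1
  rw [R50.sqrt_powScale]
  have hps : 0 ≤ powScale (q / 2) β := (powScale_pos _ _).le
  have hN : 0 ≤ 1728 * (Fintype.card (Plaquette 3 L) : ℝ) := by positivity
  calc 1728 * (Fintype.card (Plaquette 3 L) : ℝ) * β * (9 * (L : ℝ) * (5 * (powScale (1 / 2) β * btLog β ^ 2)) + powScale 1 β) ^ 2 * powScale (q / 2) β
      = 1728 * (Fintype.card (Plaquette 3 L) : ℝ) * (β * (9 * (L : ℝ) * (5 * (powScale (1 / 2) β * btLog β ^ 2)) + powScale 1 β) ^ 2) * powScale (q / 2) β := by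
        ring
    _ ≤ 1728 * (Fintype.card (Plaquette 3 L) : ℝ) * ((45 * (L : ℝ) + 1) ^ 2 * btLog β ^ 4) * powScale (q / 2) β :=
        mul_le_mul_of_nonneg_right (mul_le_mul_of_nonneg_left hup hN) hps
    _ = 1728 * (Fintype.card (Plaquette 3 L) : ℝ) * (45 * (L : ℝ) + 1) ^ 2 * Real.log β ^ 4 * powScale (q / 2) β := by rw [hℓ]; ring

/-! ## §5 The draft's other choices (informative examples) -/

/-- The draft's INPUT window `δu = powScale (1/3) β` is inside R52's band: its window floor term is affordable (`1/6 < 1/3`). [folklore] -/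
example {ε θ : ℝ} (hε : 0 < ε) (hθ : 0 < θ) :
    ∃ β0 : ℝ, ∀ β : ℝ, β0 ≤ β → ∃ b : ℝ,
      192 * (Fintype.card (Edge 3 L) : ℝ) * β * powScale (1 / 3) β * (9 * (L : ℝ) * (5 * (powScale (1 / 2) β * btLog β ^ 2)) + powScale 1 β) ^ 2 ≤ b ∧
        b ^ 2 ≤ ε * θ * bareLambda ((L : ℝ) ^ 3 * β) / 16 :=
  R52.sched_window_term_affordable (L := L) (by norm_num) hε hθ

/-- The repaired action window `σ = powScale (1/2) β` (or `powScale 1 β`) is affordable (`1/3 < 1/2`, `1/3 < 1`). [folklore] -/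
example {ε θ : ℝ} (hε : 0 < ε) (hθ : 0 < θ) :
    ∃ β0 : ℝ, ∀ β : ℝ, β0 ≤ β → ∃ b : ℝ,
      1728 * (Fintype.card (Plaquette 3 L) : ℝ) * β * (9 * (L : ℝ) * (5 * (powScale (1 / 2) β * btLog β ^ 2)) + powScale 1 β) ^ 2 *
          Real.sqrt (powScale (1 / 2) β) ≤ b ∧
        b ^ 2 ≤ ε * θ * bareLambda ((L : ℝ) ^ 3 * β) / 16 :=
  sched_action_term_affordable (L := L) (by norm_num) hε hθ

/-- Exponents: the endpoint `√(β^{-1/3}) = β^{-1/6}` is R21's borderline; the repair band `1/3 < q < 2` is non-empty (`q = 1/2`, `q = 1`), and the window floor's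
`σ ≥ 12L³a_W⁴ ≍ β^{-2}·polylog` sits at its far end. [folklore] -/
example : (1 : ℝ) / 3 / 2 = 1 / 6 ∧ (1 : ℝ) / 3 < 1 / 2 ∧ (1 : ℝ) / 2 < 2 ∧ (1 : ℝ) / 3 < 1 ∧ (1 : ℝ) < 2 := by norm_num

end Summit.QuantumFields.YangMills.Theorems.TwistedTraceScaling.Negative.R53

end
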